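import Summits.AnomalousDissipation.AnomalousDissipation.Theorems.BaireTransferRobustLoudUpgradeLine

/-!
# Line `malkin-cone-group-orbits` — LEAD'S RESHAPED skeleton (v2) for the crux
`BaireTransfer.RobustLoudUpgrade` (stmt-AnomalousDissipation-1144)

Crux (fixed, by name): `∃ S₀ ∀ S ⊇ S₀ ∀ E ε, 0 < ε → ∀ j, LOUD_j(S,E,ε) ⊆ closure (interior
LOUD_j(S,2E,ε/2))`.

LINE (planner, round 1) and RESHAPE (lead prover-line-stmt-AnomalousDissipation-1144-0, 2026-08-16).
Take the stock `S₀ := unitStock = {k : |k|∞ ≤ 1}`.  Every loud force is approximated by forces carrying a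
TAME relaxed-loud witness (`stub_tameDense`, the residual bet = "no loud ghost modulo symmetry"), where TAME
is a union of explicit witness classes, each upgraded to (the closure of) the interior of the relaxed loud
set by ONE persistence theorem at ONE fixed viscosity.  The planner's skeleton had five classes; the lead's
reshape (allowed by the card's modularity note) keeps the three whose persistence theorems are steady/elliptic
or literally the planner's, splits the steady IFT along its natural seam, ADDS a nondegeneracy-free class, and
drops two classes whose persistence theory (NHIM persistence for semiflows; Malkin–Loud for periodic orbits of a
parabolic PDE) has no support in tree or Mathlib — they re-enter the union the day their theory exists:

* `nondegSteady`  — mean-zero steady witness, strict budgets, no mean-zero classical kernel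
  → `stub_steadyPersist` (nondegenerate ⇒ the steady state PERSISTS `H¹`-continuously under small changes of
  the force, `SteadyPersistsAt`; steady IFT at fixed `ν` in the conserved-mean leaf: Fredholm alternative —
  Mathlib `IsCompactOperator.hasEigenvalue_or_mem_resolventSet` — + implicit function theorem + elliptic
  regularity, Temam 1979 Ch. II Prop. 1.1 = tree `Torus.Temam1979_steadyWeakSolution_smooth_holds`)
  → `stub_steadyWindow` (persistence + strict budget slack ⇒ `interior`; budgets of steady states are
  `∫‖u₀‖²`, `ν‖∇u₀‖²`, continuous in `H¹`);
* `censusSteady`  — NEW, nondegeneracy-FREE: at some `ν ∈ (0,a)` EVERY mean-zero classical steady state of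
  `f_c` has strict budgets → `stub_censusInterior` (`interior`): steady states EXIST for every force at every
  `ν` (Temam 1979 Ch. II Thm 1.2 = tree `Temam1979_exists_steadyWeakSolution_holds` + regularity + pressure
  recovery `smooth_helmholtz_holds`), are `H¹`-bounded a priori and precompact (Rellich,
  `Torus.isCompact_setOf_eGradNormSq_le`), limits of steady states of `f_{c_n} → f_c` are steady states of
  `f_c` with convergent budgets (energy equation `ν‖∇u‖² = (f,u)`), so a census strictly inside the window
  is force-open.  This settles the small-Grashof ("automatic", route review) regime with NO spectral input and
  is the socket for uniqueness theorems (energy method) — the lead's residual work lands `loud ∩ {small data}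
  ⊆ censusSteady` as support;
* `malkinSteady`  — THE LEVER of the idea card (mean-zero steady circle `K·u₀` of an `a`-invariant force,
  kernel = Goldstone mode only, ONE first-order-visible breaking mode) → `stub_malkinConeSteady`
  (`closure ∘ interior`; Lyapunov–Schmidt ALONG the group orbit, Malkin function linear in the force increment
  with zero `θ`-mean ⇒ sign change ⇒ open cone; engine `mem_closure_interior_of_cone` PROVED below);
* `nondegPeriodic` — periodic witness with simple Floquet multiplier `1`, stated without a period map through
  `linPeriodicSol` (planner's, verbatim) → `stub_periodicIFT` (`interior`; Henry 1981 Ch. 8).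

Dropped from the planner's union (modularity): `driftCircle` (normally hyperbolic Goldstone circle; NHIM
persistence, Bates–Lu–Zeng 1998) and `malkinPeriodic` (Malkin–Loud for 2-tori of periodic orbits).  The residual
`stub_tameDense` is correspondingly the planner's statement with the union `nondegSteady ∪ censusSteady ∪
malkinSteady ∪ nondegPeriodic` (it GAINS `censusSteady`, LOSES the two dropped classes).

VOCABULARY AND GLUE ARE IN THE TREE (v2.1): `Summits/…/Theorems/BaireTransferRobustLoudUpgradeLine.lean` (p72483, accepted
2026-08-16; namespace `Summit.AnomalousDissipation.AnomalousDissipation.Theorems.RobustLoudUpgrade`) holds `Coeff/force/loud`, all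
witness classes, `tame`, `unitStock`, the cone engine and the sorry-free composition `RobustLoudUpgrade_of` / `line_glue`; this skeleton
imports it, so the registered stubs below and their landed `--supports` files speak about the SAME declarations.
`RobustLoudUpgrade_of` composes the six stubs into the crux BY NAME (pure topology).

Disproof.lean honoured (tree `Cruxes/RobustLoudUpgrade/Disproof.lean`, gen3 v6, read in full by the lead):
`crux_false_without_pos_budget` — `0 < ε` is carried by `stub_tameDense` (at `ε = 0` every class is empty while
`LOUD(S,0,0) ∋ 0`); `not_isOpen_loud` — every class has STRICT budgets, conclusions are `interior` of the loud
set at the classes' strict budgets / `closure ∘ interior`; `mem_loud_iff_extend` caveat — all stubs live in `P_S`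
for every `S`; level is decoration (`crux_iff_levelZero`) — stubs are stated for an arbitrary ceiling `a`; §11
phase invariance and §9 scaling are available to the residual.  Vocabulary `Coeff/force/loud` is verbatim
Disproof §1 (so its lemmas transfer by `Iff.rfl`).
-/

set_option linter.dupNamespace false

noncomputable section

open scoped BigOperators Topology
open Filter Set Function TopologicalSpace MeasureTheory

namespace Summit.AnomalousDissipation.AnomalousDissipation.Cruxes.RobustLoudUpgrade.MalkinConeGroupOrbits

open Literature.Analysis.FunctionSpaces Literature.Analysis.FunctionSpaces.Torus
open Literature.Analysis.FluidPDE
open Summit.AnomalousDissipation.AnomalousDissipation.Theses.BaireTransfer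
open Summit.AnomalousDissipation.AnomalousDissipation.Theorems.RobustLoudUpgrade

/-! ## §0–§2 Vocabulary, classes, cone engine: imported from
`Summits.AnomalousDissipation.AnomalousDissipation.Theorems.BaireTransferRobustLoudUpgradeLine` (tree). -/

/-- Sanity: the imported vocabulary is the crux's (definitional). [folklore] -/
example :
    RobustLoudUpgrade ↔
      ∃ S₀ : Finset (Fin 3 → ℤ), ∀ S : Finset (Fin 3 → ℤ), S₀ ⊆ S → ∀ (E ε : ℝ), 0 < ε →
        ∀ j : ℕ, loud S (1 / ((j : ℝ) + 1)) E ε ⊆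
          closure (interior (loud S (1 / ((j : ℝ) + 1)) (2 * E) (ε / 2))) :=
  Iff.rfl

/-! ## §3 Registered stubs (v2) -/

/-- **stub_steadyPersist** (size XL; first half of the steady IFT; TRUE on paper: Foias–Temam 1977, Saut–Temam
1980 §2, Temam NSE Ch. II §1, Henry 1981 Ch. 8 for the abstract IFT).  A mean-zero classical steady state `u₀` of
`NS_ν(f_c)` whose linearisation has no eigenvalue `0` in the mean-zero class PERSISTS: for every `δ > 0` every
force `f_{c'}`, `c'` near `c`, carries a mean-zero classical steady state `δ`-close to `u₀` in squared `H¹`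
distance, at the SAME `ν` (budgets are carried along unchanged).  Route to a proof with what exists: steady NS map
`Φ(u, c') = νAu + P((u·∇)u) − f_{c'}` between `H²_{σ,0}(T³)` and `L²_{σ,0}(T³)` (Fourier side:
`TorusFourierSeries/Synthesis`, `TorusSobolevSpace`, `EnergySpaceTorus`), `C¹` (bounded bilinear + linear in
`c'`), `D_uΦ(u₀) = νA(1 + K)` with `K = (νA)⁻¹ P DB(u₀)` compact (`H² → H³ ⊂⊂ H²`), injective because an `H²`
kernel vector is smooth with a smooth pressure (elliptic regularity as in `SteadyNavierStokesRegularity`) and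
would be a classical eigenvector; Fredholm alternative (Mathlib `IsCompactOperator.hasEigenvalue_or_mem_resolventSet`,
`μ = −1`) ⇒ isomorphism; Mathlib `HasStrictFDerivAt.implicitFunction` ⇒ `u(c')`, continuous in `H² ⊂ H¹`; `u(c')`
is a steady weak solution in `V`, hence smooth (`Torus.Temam1979_steadyWeakSolution_smooth_holds`) and classical
with a smooth pressure (`smooth_helmholtz_holds` + de Rham on `T³`).
Leans on: `Torus.IsSteadyNSState`, `Torus.IsLinNSEigenvalue`, `Torus.LinNSResolventRel` (LinearizedNSTorus);
the tree's steady NS theory (`SteadyNavierStokes*`), `TorusLerayHelmholtz*`; Mathlib IFT + Fredholm alternative. -/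
theorem stub_steadyPersist :
    ∀ (S : Finset (Fin 3 → ℤ)) (a E ε : ℝ), nondegSteady S a E ε ⊆ persistSteady S a E ε := by
  sorry

/-- **stub_steadyWindow** (size M; second half of the steady IFT).  A persistent mean-zero steady witness with
STRICT budgets makes `c` an INTERIOR point of the loud set: a steady state `u'` of `f_{c'}` is a `1`-periodic
classical solution, `meanEnergy (fun _ => u') = ∫‖u'‖²`, `meanDissipation ν (fun _ => u') = ν‖∇u'‖₂²`
(`meanEnergy_eq_of_periodic`, `meanDissipation_eq_of_periodic`, `gradNormSq_eq_toReal_eGradNormSq_holds` —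
pattern `Disproof.meanEnergy_sh`), and both move by at most the strict slack when `h1DistSq u' u₀ < δ`
(Minkowski in `L²` for `u` and `∇u`); choose `δ` from the slack, take the ball of radius `r(δ)`.
Leans on: `LongTimeAveragePeriodic`, `TorusFourierCalculus` (`gradNormSq_eq_toReal_eGradNormSq_holds`),
`Torus.IsSteadyNSState`; nothing unproved. -/
theorem stub_steadyWindow :
    ∀ (S : Finset (Fin 3 → ℤ)) (a E ε : ℝ), persistSteady S a E ε ⊆ interior (loud S a E ε) := by
  sorry

/-- **stub_censusInterior** (size L; NEW, nondegeneracy-free; TRUE on paper and provable from tree material).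
If at some `ν ∈ (0,a)` every mean-zero classical steady state of `NS_ν(f_c)` has strict budgets, then
`c ∈ interior LOUD^{(0,a)}(S,E,ε)`.  Proof: if not, `c_n → c` with `c_n ∉ LOUD`; each `f_{c_n}` has a mean-zero
classical steady state `u_n` at `ν` (existence `Temam1979_exists_steadyWeakSolution_holds` + regularity
`Torus.Temam1979_steadyWeakSolution_smooth_holds` + pressure recovery: the smooth residual
`f + νΔu − (u·∇)u` is `L²`-orthogonal to smooth divergence-free mean-zero fields, hence by
`smooth_helmholtz_holds` a gradient plus a constant, and the constant is `⨍ f_{c_n} = 0`), whose budgets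
therefore violate the window; `ν‖∇u_n‖² = (f_{c_n}, u_n)` bounds `u_n` in `H¹`; Rellich
(`Torus.isCompact_setOf_eGradNormSq_le`) gives `u_{n_k} → u` in `L²`; the weak form passes to the limit
(`tendsto_integral_weakForm_of_tendsto_lintegral` pattern of `SteadyNavierStokesProofs`), so `u` is a steady weak
solution in `V` of `f_c`, smooth and classical as before, mean zero; `∫‖u_n‖² → ∫‖u‖²` and
`ν‖∇u_n‖² = (f_n,u_n) → (f_c,u) = ν‖∇u‖²`, so `u` violates the (closed complement of the strict) window —
contradicting the census.  Settles the small-Grashof regime once fed with the energy-method uniqueness theorem.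
Leans on: `SteadyNavierStokes{,Proofs,Energy,Regularity,WeakForm,Limit}`, `EnergySpaceRellich`,
`TorusLerayHelmholtz{,Proofs}`, `LongTimeAveragePeriodic`; nothing unproved. -/
theorem stub_censusInterior :
    ∀ (S : Finset (Fin 3 → ℤ)) (a E ε : ℝ), censusSteady S a E ε ⊆ interior (loud S a E ε) := by
  sorry

/-- **stub_malkinConeSteady** (size XL; THE LEVER of the idea). Lyapunov–Schmidt ALONG the circle
`θ ↦ u_θ := u₀(· − θa)` of mean-zero steady states of the `a`-invariant force `f_c` (kernel of `L_θ` =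
`ℂ·∂ₐu_θ` by hypothesis and equivariance; cokernel `ℂ·ψ_θ`, `ψ_θ = ψ₀(· − θa)`): steady states
of `f_{c + d}` near the circle ⇔ zeros of `b(θ, d) = −M_d(θ) + O(|d|²)` uniformly in `θ`, with
the MALKIN FUNCTION `M_d(θ) = ⟨ψ_θ, f_d⟩ = ∑ₖ ⟨ψ̂₀(k), f̂_d(k)⟩ e^{2πiθ k·a}` LINEAR in `d`.  For the
visible breaking `d` of the hypothesis `M_d` is a non-zero trigonometric polynomial with zero
mean, hence changes sign strictly; so does `M_{d'}` for `d'` in a ball around `d`, and for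
`0 < s < s₀` the function `b(·, s d')/s` still changes sign ⇒ IVT on the circle ⇒ a steady state
of `f_{c + s d'}` `H²`-close to some `u_θ` (same energy and dissipation as `u₀` by isometry, so
inside the strict budgets) ⇒ `c + s d' ∈ LOUD`; conclude by `mem_closure_interior_of_cone`.
No transversality in the force, no hyperbolicity, `S₀` not used (visibility is the hypothesis).
Leans on: `Torus.LinNSResolventRel` (mean-zero class = conserved-mean leaf, triage F1),
`goldstone`, torus-translation covariance of `realTrigPoly` (characters; Disproof §11 `force_phase`,
`translate_isClassical`), the cone engine above, the function-space layer of `stub_steadyPersist`;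
unvendored: LS reduction for the steady NS map with symmetry (Dancer 1984; Vanderbauwhede 1982 Ch. 8 Thm 8.2.11;
Chossat–Lauterbach 2000 Ch. 7), Fredholm alternative for `L(ν,u₀)` (Mathlib, compact operators). -/
theorem stub_malkinConeSteady :
    ∀ (S : Finset (Fin 3 → ℤ)) (a E ε : ℝ),
      malkinSteady S a E ε ⊆ closure (interior (loud S a E ε)) := by
  sorry

/-- **stub_periodicIFT** (size XL; planner's statement verbatim). A loud `τ`-periodic classical witness with
STRICT budgets whose Floquet multiplier `1` is simple (periodic kernel `= ℂ·∂ₜu`, no periodic Jordan partner of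
`∂ₜu`) makes `c` an INTERIOR point: the NS semiflow at `ν > 0` on `T³` is `C¹` (analytic) near the orbit
with compact period map (Henry1981 Ch. 8 / Thm 8.2.3-type persistence of nondegenerate periodic
orbits under `C¹` parameter change, period continuous), so nearby forces carry `C⁰([0,τ'];H¹)`-close
periodic orbits; period means = period averages (CesaroMeanPeriodic stmt-0514) move continuously.
Leans on: `linPeriodicSol`, `velocityDot`, `IsClassicalNSSolutionOn`, `meanEnergy_eq_of_periodic`
(LongTimeAveragePeriodic); unvendored: Henry1981 Ch. 8 §8.2–8.3, FoiasTemam1989 (analytic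
semiflow), periodic-parabolic Fredholm theory (Hess 1991 / Lunardi 1995 Ch. 9); in tree only the mild/strong
well-posedness fragments (`MildSolution*`, `TorusClassicalNS{Uniqueness,Restart,Gluing}`). -/
theorem stub_periodicIFT :
    ∀ (S : Finset (Fin 3 → ℤ)) (a E ε : ℝ), nondegPeriodic S a E ε ⊆ interior (loud S a E ε) := by
  sorry

/-- **stub_tameDense** (the RESIDUAL BET of the line = "no loud ghost modulo symmetry"; HARDEST; held by the
lead).  With the unit stock in `S`, every loud force is a limit in `P_S` of forces carrying a TAME relaxed-loud
witness (strict budgets `< 2E`, `> ε/2`, same viscosity window): a nondegenerate mean-zero steady state, or a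
force whose whole mean-zero steady census at one viscosity sits in the window, or a Goldstone-degenerate steady
circle with a first-order-visible breaking mode, or a nondegenerate periodic orbit.
What it EXCLUDES is the panel's common residual (Disproof §6(vi) all-directions isola centre / analytic-rank
"ghost" / trace-free "definite even-order threshold") — here WITHOUT the normally hyperbolic drift circles and the
periodic Malkin tori of the planner's union (dropped classes), i.e. a slightly STRONGER bet than the card's.
PROVED REGIME (lead, support files): the small-data / small-Grashof part of `LOUD` lies in `censusSteady`
(energy-method uniqueness + a priori bounds).  Uses `0 < ε` essentially (Disproof `crux_false_without_pos_budget`).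
Why plausible: Sard–Smale genericity in the force at fixed `ν` (FoiasTemam1976 Thm 1, SautTemam1980) plus the unit
stock breaking every continuous isotropy plus the free `ν`-slot (level decoration, Disproof §9); why it might fail:
`m₁(ν) → ∞` (FoiasTemam1976 p. 26) — first-order visibility of a FIXED stock is not guaranteed at large Grashof;
Kupka–Smale for NS under steady-force perturbations is OPEN (grounder g16-16): this stub is honestly crux-sized. -/
theorem stub_tameDense :
    ∀ S : Finset (Fin 3 → ℤ), unitStock ⊆ S → ∀ (a E ε : ℝ), 0 < a → 0 < ε →
      loud S a E ε ⊆ closure (tame S a (2 * E) (ε / 2)) := by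
  sorry

/-! ## §4 Kernel-checked composition: the six stubs prove the crux BY NAME -/

/-- **The line closes the crux**, fed with the registered stubs (so the audit sees the crux decl inhabited modulo
the six `sorry`s and nothing else); the glue `RobustLoudUpgrade_of` is the tree's (BaireTransferRobustLoudUpgradeLine). -/
theorem RobustLoudUpgrade_of_stubs :
    Summit.AnomalousDissipation.AnomalousDissipation.Theses.BaireTransfer.RobustLoudUpgrade :=
  RobustLoudUpgrade_of stub_steadyPersist stub_steadyWindow stub_censusInterior stub_malkinConeSteady
    stub_periodicIFT stub_tameDense

end Summit.AnomalousDissipation.AnomalousDissipation.Cruxes.RobustLoudUpgrade.MalkinConeGroupOrbits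

end
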